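import Summits.AtomisticToContinuum.Crystallization.Theorems.ExcessDecayLiouvilleLinearChain
import Summits.AtomisticToContinuum.Crystallization.Theorems.ExcessDecayLiouvilleDiscreteTaylor3D
import Summits.AtomisticToContinuum.Crystallization.Theorems.ExcessDecayLiouvilleLinearPart
import Summits.AtomisticToContinuum.Crystallization.Theorems.ExcessDecayLiouvilleAffineFields

/-!
# Route `ExcessDecayLiouville`: the affine-plus-shift approximant from second-difference bounds (linear levels, IX)

Linear half of the harmonic-replacement architecture for item `ExcessDecay` (stmt-AtomisticToContinuum-9334).
Purely combinatorial step: if all forward second differences `Δ_σΔ_τ h` are pointwise `≤ √Θ` on the sites of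
`B_{r'}(c₀)`, and the cross differences of the gradient at a base point `p₀ = t 0 + A z₀` near `c₀` are
`≤ √Θ`, then the field `h` is, on `S ∩ B_r(c₀)`, within `12 N² √Θ` of the affine-plus-shift field
`a_m + B(· − p₀)` built from the gradient of `h` at `p₀` (`exists_linearPart`) — here `N ≥ (400/189)(r + 11/5)`
bounds the lattice coordinates in the ball and `r' ≥ 4N + 11`:

* `pt_succ`, `dist_pt_le` : the lattice box at a base point;
* `taylor_box` : the 3-D discrete Taylor estimate (`norm_taylor3_le`) on one sublattice;
* `taylor_affine_approx` : the two sublattices glued with the common linear part `B`.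

All `[folklore]`; helper lemmas, nothing here closes an item.
-/

noncomputable section

namespace Summit.AtomisticToContinuum.Crystallization.Theorems.ExcessDecayLiouville

open scoped BigOperators Topology InnerProductSpace RealInnerProductSpace Classical
open Literature.MathematicalPhysics.StatisticalMechanics
open Summit.AtomisticToContinuum.Crystallization.Theorems.PhononStabilityNegative

-- the three forward generators of `Λ₀` and the integer lattice vector
local notation "𝐮₁" => (triangularVec₁ 1 : EuclideanSpace ℝ (Fin 3))
local notation "𝐮₂" => (triangularVec₂ 1 : EuclideanSpace ℝ (Fin 3))
local notation "𝐰₃" => (layerNormal (2 * Real.sqrt (2 / 3)) : EuclideanSpace ℝ (Fin 3))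
local notation "𝐳[" i ", " j ", " k "]" =>
  (((i : ℤ) : ℝ) • (triangularVec₁ 1 : EuclideanSpace ℝ (Fin 3)) + ((j : ℤ) : ℝ) • triangularVec₂ 1 +
    ((k : ℤ) : ℝ) • layerNormal (2 * Real.sqrt (2 / 3)))

section

variable {t : Fin 2 → (EuclideanSpace ℝ (Fin 3))} {A : (EuclideanSpace ℝ (Fin 3)) →L[ℝ] (EuclideanSpace ℝ (Fin 3))}

set_option quotPrecheck false in
-- lattice difference
local notation "Δ[" τ "] " f:max => (fun x : EuclideanSpace ℝ (Fin 3) => f (x + A τ) - f x)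

/-! ## The lattice box at a base point -/

/-- Coordinate successors are translations by the generators. [folklore] -/
theorem pt_succ (b : EuclideanSpace ℝ (Fin 3)) (i j k : ℤ) :
    b + A 𝐳[i + 1, j, k] = b + A 𝐳[i, j, k] + A 𝐮₁ ∧ b + A 𝐳[i, j + 1, k] = b + A 𝐳[i, j, k] + A 𝐮₂ ∧
      b + A 𝐳[i, j, k + 1] = b + A 𝐳[i, j, k] + A 𝐰₃ := by
  obtain ⟨h1, h2, h3⟩ := latticeVec_succ i j k
  refine ⟨?_, ?_, ?_⟩
  · rw [h1, map_add]; exact (add_assoc _ _ _).symm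
  · rw [h2, map_add]; exact (add_assoc _ _ _).symm
  · rw [h3, map_add]; exact (add_assoc _ _ _).symm

/-- Box points of index `≤ n` are within `4n` of the base point. [folklore] -/
theorem dist_pt_le (hA : Adm₀ A) (b c : EuclideanSpace ℝ (Fin 3)) {n : ℕ} {i j k : ℤ} (hi : |i| ≤ n) (hj : |j| ≤ n)
    (hk : |k| ≤ n) : dist (b + A 𝐳[i, j, k]) c ≤ dist b c + 4 * n := by
  have h1 := dist_triangle (b + A 𝐳[i, j, k]) b c
  have h2 : dist (b + A 𝐳[i, j, k]) b = ‖A 𝐳[i, j, k]‖ := by rw [dist_eq_norm, add_sub_cancel_left]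
  have hz := norm_latticeVec_le i j k
  have hi' : |((i : ℤ) : ℝ)| ≤ n := by exact_mod_cast hi
  have hj' : |((j : ℤ) : ℝ)| ≤ n := by exact_mod_cast hj
  have hk' : |((k : ℤ) : ℝ)| ≤ n := by exact_mod_cast hk
  have h3 : ‖A 𝐳[i, j, k]‖ ≤ 4 * n :=
    calc ‖A 𝐳[i, j, k]‖ ≤ ‖A‖ * ‖𝐳[i, j, k]‖ := A.le_opNorm _
      _ ≤ 1 * (4 * n) := mul_le_mul ((norm_le_of_adm₀ hA).trans (by norm_num)) (by linarith) (norm_nonneg _) zero_le_one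
      _ = 4 * n := one_mul _
  linarith

/-! ## The Taylor estimate on one sublattice -/

/-- **3-D Taylor estimate on the lattice box at `b ∈ S`**: if all forward second differences of `h` are `≤ √Θ`
in norm at the sites of `B_{r'}(c₀)`, `dist b c₀ ≤ 11/5` and `4N + 11 ≤ r'`, then for `|x|, |y|, |z| ≤ N`,
`‖h(b + A z(x,y,z)) − h b − (x•Δ_{u₁}h(b) + y•Δ_{u₂}h(b) + z•Δ_{w₃}h(b))‖ ≤ 3(x²+y²+z²)√Θ`. [folklore] -/
theorem taylor_box (hA : Adm₀ A) {h : (EuclideanSpace ℝ (Fin 3)) → (EuclideanSpace ℝ (Fin 3))} {Θ : ℝ} (hΘ : 0 ≤ Θ)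
    {c₀ : EuclideanSpace ℝ (Fin 3)} {r' : ℝ} {N : ℕ} (hr' : 4 * (N : ℝ) + 11 ≤ r')
    (hhess : ∀ x ∈ Sites₀ t A, dist x c₀ ≤ r' → ∀ σ τ : EuclideanSpace ℝ (Fin 3),
      (σ = 𝐮₁ ∨ σ = 𝐮₂ ∨ σ = 𝐰₃) → (τ = 𝐮₁ ∨ τ = 𝐮₂ ∨ τ = 𝐰₃) → ‖(Δ[σ] (Δ[τ] h)) x‖ ^ 2 ≤ Θ)
    {b : EuclideanSpace ℝ (Fin 3)} (hb : b ∈ Sites₀ t A) (hbc : dist b c₀ ≤ 11 / 5)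
    {x y z : ℤ} (hx : |x| ≤ N) (hy : |y| ≤ N) (hz : |z| ≤ N) :
    ‖h (b + A 𝐳[x, y, z]) - h b -
        (x • (Δ[𝐮₁] h) b + y • (Δ[𝐮₂] h) b + z • (Δ[𝐰₃] h) b)‖ ≤
      3 * ((x : ℝ) ^ 2 + (y : ℝ) ^ 2 + (z : ℝ) ^ 2) * Real.sqrt Θ := by
  have hu1 : (𝐮₁ : EuclideanSpace ℝ (Fin 3)) = 𝐮₁ ∨ 𝐮₁ = 𝐮₂ ∨ 𝐮₁ = 𝐰₃ := Or.inl rfl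
  have hu2 : (𝐮₂ : EuclideanSpace ℝ (Fin 3)) = 𝐮₁ ∨ 𝐮₂ = 𝐮₂ ∨ 𝐮₂ = 𝐰₃ := Or.inr (Or.inl rfl)
  have hw3 : (𝐰₃ : EuclideanSpace ℝ (Fin 3)) = 𝐮₁ ∨ 𝐰₃ = 𝐮₂ ∨ 𝐰₃ = 𝐰₃ := Or.inr (Or.inr rfl)
  -- the pointwise bound at a box point, in square-root form
  have key : ∀ i j k : ℤ, |i| ≤ N → |j| ≤ N → |k| ≤ N → ∀ σ τ : EuclideanSpace ℝ (Fin 3),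
      (σ = 𝐮₁ ∨ σ = 𝐮₂ ∨ σ = 𝐰₃) → (τ = 𝐮₁ ∨ τ = 𝐮₂ ∨ τ = 𝐰₃) →
      ‖(Δ[σ] (Δ[τ] h)) (b + A 𝐳[i, j, k])‖ ≤ Real.sqrt Θ := by
    intro i j k hi hj hk σ τ hσ hτ
    have hN2 : |i| ≤ ((N + 2 : ℕ)) ∧ |j| ≤ ((N + 2 : ℕ)) ∧ |k| ≤ ((N + 2 : ℕ)) := by
      refine ⟨hi.trans ?_, hj.trans ?_, hk.trans ?_⟩ <;> push_cast <;> linarith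
    have hd := dist_pt_le hA b c₀ hN2.1 hN2.2.1 hN2.2.2
    have hP : b + A 𝐳[i, j, k] ∈ Sites₀ t A := add_mem_sites₀ hb (latticeVec_mem_Λ₀ _ _ _)
    have hPd : dist (b + A 𝐳[i, j, k]) c₀ ≤ r' := by push_cast at hd; linarith
    exact (Real.le_sqrt (norm_nonneg _) hΘ).2 (hhess _ hP hPd σ τ hσ hτ)
  -- shifted indices still have a usable bound: we apply `key` at indices with `|·| ≤ N`
  have hS0 : 0 ≤ Real.sqrt Θ := Real.sqrt_nonneg _
  have hT := norm_taylor3_le (fun i j k => h (b + A 𝐳[i, j, k])) (N := N) hx hy hz hS0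
    (fun i j k hi hj hk => by
      have e1 := (pt_succ (A := A) b i j k).1
      have e2 : b + A 𝐳[i + 2, j, k] = b + A 𝐳[i, j, k] + A 𝐮₁ + A 𝐮₁ := by
        rw [show (i + 2 : ℤ) = i + 1 + 1 by ring, (pt_succ (A := A) b (i + 1) j k).1, e1]
      have := key i j k hi hj hk _ _ hu1 hu1
      simp only [e2, e1]
      simpa only using this)
    (fun i j k hi hj hk => by
      have e1 := (pt_succ (A := A) b i j k).2.1
      have e2 : b + A 𝐳[i, j + 2, k] = b + A 𝐳[i, j, k] + A 𝐮₂ + A 𝐮₂ := by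
        rw [show (j + 2 : ℤ) = j + 1 + 1 by ring, (pt_succ (A := A) b i (j + 1) k).2.1, e1]
      have := key i j k hi hj hk _ _ hu2 hu2
      simp only [e2, e1]
      simpa only using this)
    (fun i j k hi hj hk => by
      have e1 := (pt_succ (A := A) b i j k).2.2
      have e2 : b + A 𝐳[i, j, k + 2] = b + A 𝐳[i, j, k] + A 𝐰₃ + A 𝐰₃ := by
        rw [show (k + 2 : ℤ) = k + 1 + 1 by ring, (pt_succ (A := A) b i j (k + 1)).2.2, e1]
      have := key i j k hi hj hk _ _ hw3 hw3
      simp only [e2, e1]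
      simpa only using this)
    (fun i j k hi hj hk => by
      have ei := (pt_succ (A := A) b i j k).1
      have ej := (pt_succ (A := A) b i j k).2.1
      have e2 : b + A 𝐳[i + 1, j + 1, k] = b + A 𝐳[i, j, k] + A 𝐮₁ + A 𝐮₂ := by
        rw [(pt_succ (A := A) b (i + 1) j k).2.1, ei]
      have := key i j k hi hj hk _ _ hu1 hu2
      simp only [e2, ei, ej]
      simpa only using this)
    (fun i j k hi hj hk => by
      have ei := (pt_succ (A := A) b i j k).1
      have ek := (pt_succ (A := A) b i j k).2.2
      have e2 : b + A 𝐳[i + 1, j, k + 1] = b + A 𝐳[i, j, k] + A 𝐮₁ + A 𝐰₃ := by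
        rw [(pt_succ (A := A) b (i + 1) j k).2.2, ei]
      have := key i j k hi hj hk _ _ hu1 hw3
      simp only [e2, ei, ek]
      simpa only using this)
    (fun i j k hi hj hk => by
      have ej := (pt_succ (A := A) b i j k).2.1
      have ek := (pt_succ (A := A) b i j k).2.2
      have e2 : b + A 𝐳[i, j + 1, k + 1] = b + A 𝐳[i, j, k] + A 𝐮₂ + A 𝐰₃ := by
        rw [(pt_succ (A := A) b i (j + 1) k).2.2, ej]
      have := key i j k hi hj hk _ _ hu2 hw3
      simp only [e2, ej, ek]
      simpa only using this)
  -- identify the base values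
  have h000 : b + A 𝐳[0, 0, 0] = b := by simp
  have h100 : b + A 𝐳[1, 0, 0] = b + A 𝐮₁ := by simp
  have h010 : b + A 𝐳[0, 1, 0] = b + A 𝐮₂ := by simp
  have h001 : b + A 𝐳[0, 0, 1] = b + A 𝐰₃ := by simp
  simp only [h000, h100, h010, h001] at hT
  exact hT

/-! ## Gluing the two sublattices with a common linear part -/

/-- **Affine-plus-shift approximant from second-difference bounds** (see the module docstring). [folklore] -/
theorem taylor_affine_approx (hA : Adm₀ A) (hI : Inner₀ t A) {h : (EuclideanSpace ℝ (Fin 3)) → (EuclideanSpace ℝ (Fin 3))}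
    {Θ : ℝ} (hΘ : 0 ≤ Θ) {c₀ : EuclideanSpace ℝ (Fin 3)} {r' : ℝ}
    {z₀ : EuclideanSpace ℝ (Fin 3)} (hz₀ : z₀ ∈ Λ₀) (hp₀ : dist (t 0 + A z₀) c₀ ≤ 11 / 10)
    (hhess : ∀ x ∈ Sites₀ t A, dist x c₀ ≤ r' → ∀ σ τ : EuclideanSpace ℝ (Fin 3),
      (σ = 𝐮₁ ∨ σ = 𝐮₂ ∨ σ = 𝐰₃) → (τ = 𝐮₁ ∨ τ = 𝐮₂ ∨ τ = 𝐰₃) → ‖(Δ[σ] (Δ[τ] h)) x‖ ^ 2 ≤ Θ)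
    (hcross : ∀ τ : EuclideanSpace ℝ (Fin 3), (τ = 𝐮₁ ∨ τ = 𝐮₂ ∨ τ = 𝐰₃) →
      ‖(Δ[τ] h) (t 0 + A z₀) - (Δ[τ] h) (t 0 + A z₀ + (t 1 - t 0))‖ ^ 2 ≤ Θ) :
    ∃ (a : Fin 2 → EuclideanSpace ℝ (Fin 3)) (B : EuclideanSpace ℝ (Fin 3) →L[ℝ] EuclideanSpace ℝ (Fin 3)),
      ‖B‖ ≤ 4 * (‖(Δ[𝐮₁] h) (t 0 + A z₀)‖ + ‖(Δ[𝐮₂] h) (t 0 + A z₀)‖ + ‖(Δ[𝐰₃] h) (t 0 + A z₀)‖) ∧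
      a 0 = h (t 0 + A z₀) ∧ a 1 = h (t 1 + A z₀) - B (t 1 - t 0) ∧
      ∀ (r : ℝ) (N : ℕ), 400 / 189 * (r + 11 / 5) ≤ N → 4 * (N : ℝ) + 11 ≤ r' →
      ∀ (m : Fin 2) (z : EuclideanSpace ℝ (Fin 3)), z ∈ Λ₀ → dist (t m + A z) c₀ ≤ r →
        ‖h (t m + A z) - (a m + B (t m + A z - (t 0 + A z₀)))‖ ≤ 12 * (N : ℝ) ^ 2 * Real.sqrt Θ := by
  obtain ⟨B, hB, hBn⟩ := exists_linearPart hA ((Δ[𝐮₁] h) (t 0 + A z₀)) ((Δ[𝐮₂] h) (t 0 + A z₀))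
    ((Δ[𝐰₃] h) (t 0 + A z₀))
  refine ⟨fun m => if m = 0 then h (t 0 + A z₀) else h (t 1 + A z₀) - B (t 1 - t 0), B, hBn,
    by simp, by simp, ?_⟩
  have hS0 : 0 ≤ Real.sqrt Θ := Real.sqrt_nonneg _
  have hu1 : (𝐮₁ : EuclideanSpace ℝ (Fin 3)) = 𝐮₁ ∨ 𝐮₁ = 𝐮₂ ∨ 𝐮₁ = 𝐰₃ := Or.inl rfl
  have hu2 : (𝐮₂ : EuclideanSpace ℝ (Fin 3)) = 𝐮₁ ∨ 𝐮₂ = 𝐮₂ ∨ 𝐮₂ = 𝐰₃ := Or.inr (Or.inl rfl)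
  have hw3 : (𝐰₃ : EuclideanSpace ℝ (Fin 3)) = 𝐮₁ ∨ 𝐰₃ = 𝐮₂ ∨ 𝐰₃ = 𝐰₃ := Or.inr (Or.inr rfl)
  intro r N hN hr' m z hz hq
  -- integer coordinates of `z − z₀`
  obtain ⟨x, y, w, hxyz⟩ := hcpLiouvilleLam_sub_mem hz hz₀
  have hbm : t m + A z = (t m + A z₀) + A 𝐳[x, y, w] := by
    rw [← hxyz, map_sub]; abel
  have hbS : t m + A z₀ ∈ Sites₀ t A := ⟨m, z₀, hz₀, rfl⟩
  have hbc : dist (t m + A z₀) c₀ ≤ 11 / 5 := by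
    have h1 := dist_triangle (t m + A z₀) (t 0 + A z₀) c₀
    have h2 : dist (t m + A z₀) (t 0 + A z₀) = ‖t m - t 0‖ := by
      rw [dist_eq_norm]; congr 1; abel
    have h3 : ‖t m - t 0‖ ≤ 11 / 10 := norm_t_sub_t0_le hA hI m
    linarith
  -- coordinate bounds
  have hAz : ‖A 𝐳[x, y, w]‖ ≤ r + 11 / 5 := by
    have : ‖A 𝐳[x, y, w]‖ = dist (t m + A z) (t m + A z₀) := by rw [hbm, dist_eq_norm, add_sub_cancel_left]
    rw [this]
    have := dist_triangle (t m + A z) c₀ (t m + A z₀)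
    rw [dist_comm c₀] at this
    linarith
  obtain ⟨hxi, hyi, hwi⟩ := abs_coord_le_norm_apply_latticeVec hA x y w
  have hAz' : 400 / 189 * ‖A 𝐳[x, y, w]‖ ≤ N := by
    have := mul_le_mul_of_nonneg_left hAz (by norm_num : (0 : ℝ) ≤ 400 / 189)
    linarith
  have hAz'' : 200 / 189 * ‖A 𝐳[x, y, w]‖ ≤ 400 / 189 * ‖A 𝐳[x, y, w]‖ := by
    have := norm_nonneg (A 𝐳[x, y, w]); nlinarith
  have hxR : |(x : ℝ)| ≤ N := hxi.trans hAz'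
  have hyR : |(y : ℝ)| ≤ N := hyi.trans hAz'
  have hwR : |(w : ℝ)| ≤ N := hwi.trans (hAz''.trans hAz')
  have hxN : |x| ≤ N := by exact_mod_cast hxR
  have hyN : |y| ≤ N := by exact_mod_cast hyR
  have hwN : |w| ≤ N := by exact_mod_cast hwR
  have hN0 : (0 : ℝ) ≤ N := Nat.cast_nonneg _
  have hsq : (x : ℝ) ^ 2 + (y : ℝ) ^ 2 + (w : ℝ) ^ 2 ≤ 3 * (N : ℝ) ^ 2 := by
    have h1 : (x : ℝ) ^ 2 ≤ (N : ℝ) ^ 2 := by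
      have := pow_le_pow_left₀ (abs_nonneg _) hxR 2; rwa [sq_abs] at this
    have h2 : (y : ℝ) ^ 2 ≤ (N : ℝ) ^ 2 := by
      have := pow_le_pow_left₀ (abs_nonneg _) hyR 2; rwa [sq_abs] at this
    have h3 : (w : ℝ) ^ 2 ≤ (N : ℝ) ^ 2 := by
      have := pow_le_pow_left₀ (abs_nonneg _) hwR 2; rwa [sq_abs] at this
    linarith
  -- Taylor on the sublattice of `m`
  have hT := taylor_box hA hΘ hr' hhess hbS hbc hxN hyN hwN
  have hT' : ‖h (t m + A z) - h (t m + A z₀) -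
      (x • (Δ[𝐮₁] h) (t m + A z₀) + y • (Δ[𝐮₂] h) (t m + A z₀) + w • (Δ[𝐰₃] h) (t m + A z₀))‖ ≤
      9 * (N : ℝ) ^ 2 * Real.sqrt Θ := by
    rw [hbm]
    refine hT.trans ?_
    have := mul_le_mul_of_nonneg_right hsq hS0
    nlinarith [this]
  have hdiff : t m + A z - (t 0 + A z₀) = A 𝐳[x, y, w] + (t m - t 0) := by
    rw [hbm]; abel
  have hNN : (N : ℝ) ≤ (N : ℝ) ^ 2 := by
    rcases Nat.eq_zero_or_pos N with hN0' | hN0'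
    · simp [hN0']
    · have : (1 : ℝ) ≤ N := by exact_mod_cast hN0'
      nlinarith
  -- the gradient at the base point of sublattice `m` versus that at `t 0 + A z₀`
  have hgrad : ∀ {τ : EuclideanSpace ℝ (Fin 3)}, (τ = 𝐮₁ ∨ τ = 𝐮₂ ∨ τ = 𝐰₃) →
      ‖(Δ[τ] h) (t m + A z₀) - (Δ[τ] h) (t 0 + A z₀)‖ ≤ Real.sqrt Θ := by
    intro τ hτ
    by_cases hm : m = 0
    · subst hm
      rw [sub_self, norm_zero]; exact hS0
    · obtain rfl : m = 1 := by
        fin_cases m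
        · exact absurd rfl hm
        · rfl
      have h1 := hcross τ hτ
      have e1 : t 0 + A z₀ + (t 1 - t 0) = t 1 + A z₀ := by abel
      rw [e1, ← norm_sub_rev] at h1
      exact (Real.le_sqrt (norm_nonneg _) hΘ).2 h1
  have hc1 := hgrad hu1
  have hc2 := hgrad hu2
  have hc3 := hgrad hw3
  generalize hE₁ : (Δ[𝐮₁] h) (t m + A z₀) = E₁ at hT' hc1
  generalize hE₂ : (Δ[𝐮₂] h) (t m + A z₀) = E₂ at hT' hc2
  generalize hE₃ : (Δ[𝐰₃] h) (t m + A z₀) = E₃ at hT' hc3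
  generalize hD₁ : (Δ[𝐮₁] h) (t 0 + A z₀) = D₁ at hB hc1
  generalize hD₂ : (Δ[𝐮₂] h) (t 0 + A z₀) = D₂ at hB hc2
  generalize hD₃ : (Δ[𝐰₃] h) (t 0 + A z₀) = D₃ at hB hc3
  have hcorr : ‖x • (E₁ - D₁) + y • (E₂ - D₂) + w • (E₃ - D₃)‖ ≤ 3 * (N : ℝ) * Real.sqrt Θ := by
    have n1 : ‖x • (E₁ - D₁)‖ ≤ (N : ℝ) * Real.sqrt Θ := by
      rw [norm_zsmul ℝ, Real.norm_eq_abs]; exact mul_le_mul hxR hc1 (norm_nonneg _) hN0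
    have n2 : ‖y • (E₂ - D₂)‖ ≤ (N : ℝ) * Real.sqrt Θ := by
      rw [norm_zsmul ℝ, Real.norm_eq_abs]; exact mul_le_mul hyR hc2 (norm_nonneg _) hN0
    have n3 : ‖w • (E₃ - D₃)‖ ≤ (N : ℝ) * Real.sqrt Θ := by
      rw [norm_zsmul ℝ, Real.norm_eq_abs]; exact mul_le_mul hwR hc3 (norm_nonneg _) hN0
    calc ‖x • (E₁ - D₁) + y • (E₂ - D₂) + w • (E₃ - D₃)‖
        ≤ ‖x • (E₁ - D₁)‖ + ‖y • (E₂ - D₂)‖ + ‖w • (E₃ - D₃)‖ := norm_add₃_le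
      _ ≤ 3 * (N : ℝ) * Real.sqrt Θ := by linarith
  -- the value of the approximant
  have hBz : B (A 𝐳[x, y, w]) = x • D₁ + y • D₂ + w • D₃ := by
    rw [hB x y w, Int.cast_smul_eq_zsmul ℝ x D₁, Int.cast_smul_eq_zsmul ℝ y D₂, Int.cast_smul_eq_zsmul ℝ w D₃]
  have hval : (if m = 0 then h (t 0 + A z₀) else h (t 1 + A z₀) - B (t 1 - t 0)) + B (t m + A z - (t 0 + A z₀)) =
      h (t m + A z₀) + (x • D₁ + y • D₂ + w • D₃) := by
    rw [hdiff, map_add, hBz]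
    by_cases hm : m = 0
    · subst hm
      rw [if_pos rfl, sub_self, map_zero, add_zero]
    · obtain rfl : m = 1 := by
        fin_cases m
        · exact absurd rfl hm
        · rfl
      rw [if_neg one_ne_zero]
      abel
  have hsplit : h (t m + A z) - ((if m = 0 then h (t 0 + A z₀) else h (t 1 + A z₀) - B (t 1 - t 0)) +
      B (t m + A z - (t 0 + A z₀))) =
      (h (t m + A z) - h (t m + A z₀) - (x • E₁ + y • E₂ + w • E₃)) +
        (x • (E₁ - D₁) + y • (E₂ - D₂) + w • (E₃ - D₃)) := by
    rw [hval, zsmul_sub, zsmul_sub, zsmul_sub]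
    abel
  show ‖h (t m + A z) - ((if m = 0 then h (t 0 + A z₀) else h (t 1 + A z₀) - B (t 1 - t 0)) +
      B (t m + A z - (t 0 + A z₀)))‖ ≤ 12 * (N : ℝ) ^ 2 * Real.sqrt Θ
  rw [hsplit]
  calc ‖(h (t m + A z) - h (t m + A z₀) - (x • E₁ + y • E₂ + w • E₃)) +
        (x • (E₁ - D₁) + y • (E₂ - D₂) + w • (E₃ - D₃))‖
      ≤ ‖h (t m + A z) - h (t m + A z₀) - (x • E₁ + y • E₂ + w • E₃)‖ +
        ‖x • (E₁ - D₁) + y • (E₂ - D₂) + w • (E₃ - D₃)‖ := norm_add_le _ _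
    _ ≤ 9 * (N : ℝ) ^ 2 * Real.sqrt Θ + 3 * (N : ℝ) * Real.sqrt Θ := add_le_add hT' hcorr
    _ ≤ 12 * (N : ℝ) ^ 2 * Real.sqrt Θ := by nlinarith [mul_le_mul_of_nonneg_right hNN hS0]

end

end Summit.AtomisticToContinuum.Crystallization.Theorems.ExcessDecayLiouville

end
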